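import Summits.QuantumFields.YangMills.Theorems.BalabanLadderIRPinnedExit96
import HarnessLib

/-!
# Crux `BalabanLadder.IR` ∕ `IRcof` (stmt-QuantumFields-19354 ∕ 26930): THE NUMBER is a PURITY MASS IN FLOOR UNITS —
# PX(1/24) ↔ «β-uniform exponential purity law for EVERY cold box beyond `T` floor-lengths» ↔ «the ONE box of side `⌈T/a(β)⌉` is 96 %-pure»
# (helper; LEAD prover ym-ir-line-ab-p1 gen 7, slot custody; def-free calibration)

HONEST STATUS.  Bookkeeping over the landed purity climb and coupling-axis decay; nothing here proves PX(1/24), PXcof(1/24) (THE NUMBER),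
`BalabanLadder.IR` (19354), `IRcof` (26930), or the Clay Yang–Mills mass gap (NOT proved anywhere in this tree; R4 = the conditional
finite-𝕋⁴ rung `BalabanLadder.UV` only).  Width 0 toward the stubs.

The slots of record register `stub_pinnedExit96 : PinnedExit96.PinnedExitAt (1/24)` (19354: per `β`, SOME cold `4:1` box of side `L ∈ [8, T/a(β)]`
has `δᶜ_β(L) ≤ 1/24`) and `stub_pinnedExitsCofinal : PinnedExitsCofinalAt (1/24)` (26930: the same at cofinally many `β`; body spelled out below
verbatim as in `BalabanLadderIRPinnedToleranceInvariance` ∕ `IR/Negative/PinnedExitVacuityThreshold`).  The `∃ L ≤ T/a(β)` in these statements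
LOOKS like slack (a search over boxes, one box per coupling).  THIS FILE removes it, in the kernel:

* `rate_of_pinnedPureBox` (model side, one coupling `β ≥ 0`): a `1/24`-pure cold box of side `L ≥ 8` pinned by `s·L ≤ T` forces
  `δᶜ_β(P) ≤ exp(−s·P ∕ (2¹⁴·T))` for EVERY `P` with `s·P ≥ 2¹⁵·T` — purity climb `coldDefect_widen_24` (`1/24 → 2⁻²⁵` at `2¹⁴L`) + the landed
  decay `CouplingAxis.decay_of_exit`; the rate `s/(2¹⁴T)` is read off `2¹⁴L ≤ 2¹⁴T/s`.  `pinnedPureBox_of_rate`: conversely a purity law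
  `δᶜ_β(P) ≤ exp(−c·s·P)` on `s·P ≥ T` (`0 < s ≤ 1`) puts a `1/24`-pure box at `L = max 8 ⌈max(T, log 24 ∕ c)/s⌉₊`, pinned by `max 8 (max(T, log 24/c) + 1)`.
* `pinnedExitAt24_iff_rateForm` — **PX(1/24) ↔ RATE FORM**: under the crux's own hypotheses (`a > 0`, `a → 0`, `LowerBounds G r a`) there are
  `T, c > 0, β₁` with `δᶜ_β(P) ≤ exp(−c·a(β)·P)` for ALL `β ≥ β₁` and ALL `P ≥ T/a(β)`.  In words: THE NUMBER is EXACTLY «the cold `4:1` torus has a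
  purity mass `≥ c` in floor units, uniformly in the coupling, on every box longer than `T` floor-lengths» — the partition-function-side twin of
  `GapInUnits` (rate `c₁·a(β)`), with no search over boxes and no tolerance left (cf. `Tolerance.pinnedExitAt_iff_24`).
* `pinnedExitAt24_iff_designated` — **PX(1/24) ↔ DESIGNATED-BOX FORM**: `∃ T > 0, β₁` with `δᶜ_β(⌈T/a(β)⌉₊) ≤ 1/24` for all `β ≥ β₁` — ONE prescribed
  box per coupling (the box of physical side `T`), which is the form every instrument row of `pub/ym-ir/FINITE-BOX-PURITY.md` actually measures.
* `pinnedExitsCofinalAt24_iff_rateForm` ∕ `pinnedExitsCofinalAt24_iff_designated` — the same two re-typings for the COFINAL slot PXcof(1/24) of 26930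
  (`∀ β₁ ∃ β ≥ β₁` in place of `∃ β₁ ∀ β ≥ β₁`; `T`, `c` chosen BEFORE `β₁`).

READING (numbers, not adjectives): constants are explicit — pin `T ↦ 2¹⁵T`, rate `c = 1/(2¹⁴T)` one way; pin `max 8 (max(T, log 24/c) + 1)` back.
No new definition; no hypothesis weakened or strengthened; the floor `LowerBounds` is carried, never used (it is used by the slots' consumers).

References: tree `BalabanLadderIRPinnedExit96` (PX, idea-14 ∕ LEAD g5), `BalabanLadderIRPurityClimb24` (`coldDefect_widen_24`),
`BalabanLadderIRCouplingAxisTransport` (`decay_of_exit`), `BalabanLadderIRPinnedToleranceInvariance` (LEAD g6); M. Lüscher, Commun. Math. Phys. 104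
(1986) 177 and Nucl. Phys. B219 (1983) 233 (finite-volume spectrum in physical units — background only, nothing cited as a fact).
-/

noncomputable section

open Filter Topology
open Literature.MathematicalPhysics.QuantumFieldTheory
open Summit.QuantumFields.YangMills.Cruxes.OSLegsFromFemtoAndGap.DlrCollarTransfer (LowerBounds)
open Summit.QuantumFields.YangMills.Cruxes.IR.ColdPurityBridge (coldDefect)
open Summit.QuantumFields.YangMills.Cruxes.IR.PinnedExit96 (PinnedExitAt)
open Summit.QuantumFields.YangMills.Cruxes.IR.PurityClimb (coldDefect_widen_24)
open Summit.QuantumFields.YangMills.Cruxes.IR.CouplingAxis (decay_of_exit)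

namespace Summit.QuantumFields.YangMills.Cruxes.IR.PinnedExit96.RateForm

/-! ## §1 Model side: one coupling, one pinned pure box ↔ an exponential purity law in the pin's units -/

section Model

variable {G : Type} [Group G] [TopologicalSpace G] [IsTopologicalGroup G] [CompactSpace G]
  [MeasurableSpace G] [BorelSpace G]

/-- `M ≤ s·⌈M/s⌉₊` for `s > 0` (any sign of `M`). -/
theorem le_mul_ceil_div {M s : ℝ} (hs : 0 < s) : M ≤ s * (⌈M / s⌉₊ : ℕ) := by
  have h : M / s ≤ (⌈M / s⌉₊ : ℕ) := Nat.le_ceil _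
  have := mul_le_mul_of_nonneg_left h hs.le
  rwa [mul_div_cancel₀ _ hs.ne'] at this

/-- `s·⌈M/s⌉₊ ≤ max 0 M + s` for `s > 0`. -/
theorem mul_ceil_div_le {M s : ℝ} (hs : 0 < s) : s * (⌈M / s⌉₊ : ℕ) ≤ max 0 M + s := by
  rcases le_or_gt M 0 with hM | hM
  · have h0 : ⌈M / s⌉₊ = 0 := Nat.ceil_eq_zero.2 (div_nonpos_of_nonpos_of_nonneg hM hs.le)
    rw [h0, max_eq_left hM]
    simp [hs.le]
  · have hMs : 0 ≤ M / s := div_nonneg hM.le hs.le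
    have h1 : ((⌈M / s⌉₊ : ℕ) : ℝ) < M / s + 1 := Nat.ceil_lt_add_one hMs
    have h2 := mul_le_mul_of_nonneg_left h1.le hs.le
    rw [max_eq_right hM.le]
    calc s * (⌈M / s⌉₊ : ℕ) ≤ s * (M / s + 1) := h2
      _ = M + s := by field_simp

/-- `exp(−log 24) = 1/24`. -/
theorem exp_neg_log_24 : Real.exp (-Real.log 24) = 1 / 24 := by
  rw [Real.exp_neg, Real.exp_log (by norm_num : (0 : ℝ) < 24), one_div]

/-- **Rate from ONE pinned pure box (PROVED, model side).**  At a coupling `β ≥ 0`: a cold `4:1` box of side `L ≥ 8` with `δᶜ_β(L) ≤ 1/24`,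
pinned by `s·L ≤ T` (`s > 0` the floor scale at this coupling), forces the exponential purity law `δᶜ_β(P) ≤ exp(−s·P ∕ (2¹⁴·T))` for every
box with `s·P ≥ 2¹⁵·T`.  Proof: `coldDefect_widen_24` makes `2¹⁴L` a `2⁻²⁵ ≤ 2⁻²⁴`-pure box; `decay_of_exit` gives `δᶜ_β(P) ≤ 2⁻²⁰·exp(−(P+1)/(2¹⁴L))`
for `P ≥ 2¹⁵L`, and `2¹⁴L ≤ 2¹⁴T/s`. -/
theorem rate_of_pinnedPureBox (r : LatticeRep G) {β s T : ℝ} (hβ0 : 0 ≤ β) (hs : 0 < s) {L : ℕ} (hL : 8 ≤ L)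
    (hpin : s * (L : ℝ) ≤ T) (hδ : coldDefect r.ρ β L ≤ 1 / 24) :
    ∀ P : ℕ, 32768 * T ≤ s * (P : ℝ) → coldDefect r.ρ β P ≤ Real.exp (-(s * (P : ℝ) / (16384 * T))) := by
  intro P hP
  have hLpos : (0 : ℝ) < (L : ℝ) := by exact_mod_cast (show 0 < L by omega)
  have hT : 0 < T := lt_of_lt_of_le (mul_pos hs hLpos) hpin
  have h24 : coldDefect r.ρ β (16384 * L) ≤ 1 / 2 ^ 24 := (coldDefect_widen_24 r hβ0 L hL hδ).trans (by norm_num)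
  have hLs8 : 8 ≤ 16384 * L := by omega
  have hP2 : 2 * (16384 * L) ≤ P := by
    have h1 : s * ((2 * (16384 * L) : ℕ) : ℝ) ≤ s * (P : ℝ) := by
      calc s * ((2 * (16384 * L) : ℕ) : ℝ) = 32768 * (s * (L : ℝ)) := by push_cast; ring
        _ ≤ 32768 * T := by linarith
        _ ≤ s * (P : ℝ) := hP
    exact_mod_cast le_of_mul_le_mul_left h1 hs
  have hdec := decay_of_exit r hβ0 hLs8 h24 P hP2
  refine hdec.trans ?_
  have hLs : (0 : ℝ) < ((16384 * L : ℕ) : ℝ) := by positivity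
  have hkey : s * (P : ℝ) / (16384 * T) ≤ ((P : ℝ) + 1) / ((16384 * L : ℕ) : ℝ) := by
    rw [div_le_div_iff₀ (by positivity) hLs]
    push_cast
    have hP0 : (0 : ℝ) ≤ (P : ℝ) := by positivity
    nlinarith [mul_le_mul_of_nonneg_right hpin hP0]
  calc ((2 : ℝ) ^ 20)⁻¹ * Real.exp (-(((P : ℝ) + 1) / ((16384 * L : ℕ) : ℝ)))
      ≤ 1 * Real.exp (-(((P : ℝ) + 1) / ((16384 * L : ℕ) : ℝ))) := by gcongr; norm_num
    _ = Real.exp (-(((P : ℝ) + 1) / ((16384 * L : ℕ) : ℝ))) := one_mul _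
    _ ≤ Real.exp (-(s * (P : ℝ) / (16384 * T))) := by
        rw [Real.exp_le_exp, neg_le_neg_iff]; exact hkey

/-- **A pinned pure box from a rate (PROVED, model side).**  At one coupling: an exponential purity law `δᶜ_β(P) ≤ exp(−c·s·P)` on all boxes
with `s·P ≥ T` (`c > 0`, floor scale `0 < s ≤ 1`) puts a `1/24`-pure cold box at `L := max 8 ⌈max(T, log 24/c)/s⌉₊ ≥ 8`, pinned by
`s·L ≤ max 8 (max(T, log 24/c) + 1)`. -/
theorem pinnedPureBox_of_rate (r : LatticeRep G) {β s T c : ℝ} (hs : 0 < s) (hs1 : s ≤ 1) (hc : 0 < c)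
    (hrate : ∀ P : ℕ, T ≤ s * (P : ℝ) → coldDefect r.ρ β P ≤ Real.exp (-(c * (s * (P : ℝ))))) :
    ∃ L : ℕ, 8 ≤ L ∧ s * (L : ℝ) ≤ max 8 (max T (Real.log 24 / c) + 1) ∧ coldDefect r.ρ β L ≤ 1 / 24 := by
  set M : ℝ := max T (Real.log 24 / c) with hM
  refine ⟨max 8 ⌈M / s⌉₊, le_max_left _ _, ?_, ?_⟩
  · rcases le_total 8 ⌈M / s⌉₊ with h | h
    · rw [max_eq_right h]
      calc s * (⌈M / s⌉₊ : ℕ) ≤ max 0 M + s := mul_ceil_div_le hs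
        _ ≤ max 0 M + 1 := by linarith
        _ ≤ max 8 (M + 1) := by
            rcases le_total 0 M with h0 | h0
            · rw [max_eq_right h0]; exact le_max_right _ _
            · rw [max_eq_left h0]; linarith [le_max_left (8 : ℝ) (M + 1)]
    · rw [max_eq_left h]
      push_cast
      linarith [le_max_left (8 : ℝ) (M + 1)]
  · have hTM : T ≤ s * ((max 8 ⌈M / s⌉₊ : ℕ) : ℝ) := by
      calc T ≤ M := le_max_left _ _
        _ ≤ s * (⌈M / s⌉₊ : ℕ) := le_mul_ceil_div hs
        _ ≤ s * ((max 8 ⌈M / s⌉₊ : ℕ) : ℝ) := by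
            gcongr
            exact_mod_cast le_max_right _ _
    refine (hrate _ hTM).trans ?_
    rw [← exp_neg_log_24, Real.exp_le_exp, neg_le_neg_iff]
    have hlog : Real.log 24 ≤ c * M := by
      have : Real.log 24 / c ≤ M := le_max_right _ _
      rwa [div_le_iff₀ hc, mul_comm] at this
    calc Real.log 24 ≤ c * M := hlog
      _ ≤ c * (s * (⌈M / s⌉₊ : ℕ)) := by gcongr; exact le_mul_ceil_div hs
      _ ≤ c * (s * ((max 8 ⌈M / s⌉₊ : ℕ) : ℝ)) := by
          gcongr
          exact_mod_cast le_max_right _ _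

/-- **The designated box from a rate (PROVED, model side).**  Under the purity law `δᶜ_β(P) ≤ exp(−c·s·P)` on `s·P ≥ T` (`c, s > 0`), the ONE box
`P := ⌈T'/s⌉₊` with `T' := max T (log 24/c)` is `1/24`-pure. -/
theorem designatedBox_of_rate (r : LatticeRep G) {β s T c : ℝ} (hs : 0 < s) (hc : 0 < c)
    (hrate : ∀ P : ℕ, T ≤ s * (P : ℝ) → coldDefect r.ρ β P ≤ Real.exp (-(c * (s * (P : ℝ))))) :
    coldDefect r.ρ β ⌈max T (Real.log 24 / c) / s⌉₊ ≤ 1 / 24 := by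
  set M : ℝ := max T (Real.log 24 / c) with hM
  have hTM : T ≤ s * ((⌈M / s⌉₊ : ℕ) : ℝ) := (le_max_left _ _).trans (le_mul_ceil_div hs)
  refine (hrate _ hTM).trans ?_
  rw [← exp_neg_log_24, Real.exp_le_exp, neg_le_neg_iff]
  have hlog : Real.log 24 ≤ c * M := by
    have : Real.log 24 / c ≤ M := le_max_right _ _
    rwa [div_le_iff₀ hc, mul_comm] at this
  calc Real.log 24 ≤ c * M := hlog
    _ ≤ c * (s * (⌈M / s⌉₊ : ℕ)) := by gcongr; exact le_mul_ceil_div hs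

/-- **A pinned pure box from the designated box (PROVED, model side).**  If `0 < s ≤ min 1 (T/8)` and the box `⌈T/s⌉₊` is `1/24`-pure, then it is a
pinned pure box: `8 ≤ ⌈T/s⌉₊` and `s·⌈T/s⌉₊ ≤ T + 1`. -/
theorem pinnedPureBox_of_designated (r : LatticeRep G) {β s T : ℝ} (hs : 0 < s) (hs1 : s ≤ 1) (hs8 : s ≤ T / 8)
    (hδ : coldDefect r.ρ β ⌈T / s⌉₊ ≤ 1 / 24) :
    ∃ L : ℕ, 8 ≤ L ∧ s * (L : ℝ) ≤ T + 1 ∧ coldDefect r.ρ β L ≤ 1 / 24 := by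
  have hT : 0 < T := by linarith
  refine ⟨⌈T / s⌉₊, ?_, ?_, hδ⟩
  · have h8 : (8 : ℝ) ≤ T / s := by rw [le_div_iff₀ hs]; linarith [(le_div_iff₀ (by norm_num : (0:ℝ) < 8)).1 hs8]
    have : (8 : ℝ) ≤ (⌈T / s⌉₊ : ℕ) := h8.trans (Nat.le_ceil _)
    exact_mod_cast this
  · calc s * (⌈T / s⌉₊ : ℕ) ≤ max 0 T + s := mul_ceil_div_le hs
      _ = T + s := by rw [max_eq_right hT.le]
      _ ≤ T + 1 := by linarith

end Model

/-- Eventually `a β ≤ b` for any `b > 0`, from `a → 0`. -/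
theorem eventually_le_of_tendsto_zero {a : ℝ → ℝ} (ha0 : Tendsto a atTop (𝓝 0)) {b : ℝ} (hb : 0 < b) :
    ∃ βa : ℝ, ∀ β : ℝ, βa ≤ β → a β ≤ b := by
  have hev : ∀ᶠ β in atTop, a β < b := ha0.eventually (gt_mem_nhds hb)
  obtain ⟨βa, h⟩ := Filter.eventually_atTop.1 hev
  exact ⟨βa, fun β hβ => (h β hβ).le⟩

/-! ## §2 PX(1/24) ↔ RATE FORM (slot of record on 19354) -/

/-- **PX(1/24) ⇒ rate form (PROVED).**  Pin `2¹⁵T`, rate `c = 1/(2¹⁴T)`, threshold `max β₁ 0`. -/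
theorem rateForm_of_pinnedExitAt24 (hP : PinnedExitAt (1 / 24)) :
    ∀ (G : Type) [Group G] [TopologicalSpace G] [IsTopologicalGroup G] [CompactSpace G],
      IsCompactSimpleLieGroup G → SimplyConnectedSpace G →
      letI : MeasurableSpace G := borel G
      haveI : BorelSpace G := ⟨rfl⟩
      ∀ (r : LatticeRep G) (a : ℝ → ℝ), (∀ β, 0 < a β) → Tendsto a atTop (𝓝 0) → LowerBounds G r a →
        ∃ T c β₁ : ℝ, 0 < c ∧ ∀ β : ℝ, β₁ ≤ β → ∀ P : ℕ, T ≤ a β * (P : ℝ) →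
          coldDefect r.ρ β P ≤ Real.exp (-(c * (a β * (P : ℝ)))) := by
  intro G _ _ _ _ hG hsc
  letI : MeasurableSpace G := borel G
  haveI : BorelSpace G := ⟨rfl⟩
  intro r a ha ha0 hlb
  obtain ⟨T, β₁, hpx⟩ := hP G hG hsc r a ha ha0 hlb
  have hT : 0 < T := by
    obtain ⟨L, hL8, hpin, -⟩ := hpx (max β₁ 0) (le_max_left _ _)
    have hLpos : (0 : ℝ) < (L : ℝ) := by exact_mod_cast (show 0 < L by omega)
    exact lt_of_lt_of_le (mul_pos (ha _) hLpos) hpin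
  refine ⟨32768 * T, 1 / (16384 * T), max β₁ 0, by positivity, fun β hβ P hPT => ?_⟩
  have hβ1 : β₁ ≤ β := le_trans (le_max_left _ _) hβ
  have hβ0 : (0 : ℝ) ≤ β := le_trans (le_max_right _ _) hβ
  obtain ⟨L, hL8, hpin, hδ⟩ := hpx β hβ1
  have h := rate_of_pinnedPureBox r hβ0 (ha β) hL8 hpin hδ P hPT
  have heq : 1 / (16384 * T) * (a β * (P : ℝ)) = a β * (P : ℝ) / (16384 * T) := by ring
  rwa [heq]

/-- **Rate form ⇒ PX(1/24) (PROVED).**  Pin `max 8 (max(T, log 24/c) + 1)`, threshold `max β₁ βa` with `a ≤ 1` beyond `βa`. -/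
theorem pinnedExitAt24_of_rateForm
    (hR : ∀ (G : Type) [Group G] [TopologicalSpace G] [IsTopologicalGroup G] [CompactSpace G],
      IsCompactSimpleLieGroup G → SimplyConnectedSpace G →
      letI : MeasurableSpace G := borel G
      haveI : BorelSpace G := ⟨rfl⟩
      ∀ (r : LatticeRep G) (a : ℝ → ℝ), (∀ β, 0 < a β) → Tendsto a atTop (𝓝 0) → LowerBounds G r a →
        ∃ T c β₁ : ℝ, 0 < c ∧ ∀ β : ℝ, β₁ ≤ β → ∀ P : ℕ, T ≤ a β * (P : ℝ) →
          coldDefect r.ρ β P ≤ Real.exp (-(c * (a β * (P : ℝ))))) :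
    PinnedExitAt (1 / 24) := by
  intro G _ _ _ _ hG hsc
  letI : MeasurableSpace G := borel G
  haveI : BorelSpace G := ⟨rfl⟩
  intro r a ha ha0 hlb
  obtain ⟨T, c, β₁, hc, hrate⟩ := hR G hG hsc r a ha ha0 hlb
  obtain ⟨βa, hβa⟩ := eventually_le_of_tendsto_zero ha0 one_pos
  refine ⟨max 8 (max T (Real.log 24 / c) + 1), max β₁ βa, fun β hβ => ?_⟩
  have hβ1 : β₁ ≤ β := le_trans (le_max_left _ _) hβ
  have hβa' : βa ≤ β := le_trans (le_max_right _ _) hβ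
  exact pinnedPureBox_of_rate r (ha β) (hβa β hβa') hc (hrate β hβ1)

/-- **PX(1/24) ↔ RATE FORM (PROVED): THE NUMBER is a β-uniform purity mass `≥ c` in floor units on every cold box beyond `T` floor-lengths.** -/
theorem pinnedExitAt24_iff_rateForm :
    PinnedExitAt (1 / 24) ↔
    ∀ (G : Type) [Group G] [TopologicalSpace G] [IsTopologicalGroup G] [CompactSpace G],
      IsCompactSimpleLieGroup G → SimplyConnectedSpace G →
      letI : MeasurableSpace G := borel G
      haveI : BorelSpace G := ⟨rfl⟩
      ∀ (r : LatticeRep G) (a : ℝ → ℝ), (∀ β, 0 < a β) → Tendsto a atTop (𝓝 0) → LowerBounds G r a →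
        ∃ T c β₁ : ℝ, 0 < c ∧ ∀ β : ℝ, β₁ ≤ β → ∀ P : ℕ, T ≤ a β * (P : ℝ) →
          coldDefect r.ρ β P ≤ Real.exp (-(c * (a β * (P : ℝ)))) :=
  ⟨rateForm_of_pinnedExitAt24, pinnedExitAt24_of_rateForm⟩

/-! ## §3 PX(1/24) ↔ DESIGNATED-BOX FORM (one prescribed box per coupling) -/

/-- **PX(1/24) ⇒ designated-box form (PROVED)**: with `T' := max (2¹⁵T) (2¹⁴T·log 24) > 0`, the box `⌈T'/a(β)⌉₊` is `1/24`-pure for all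
`β ≥ max β₁ 0`. -/
theorem designated_of_pinnedExitAt24 (hP : PinnedExitAt (1 / 24)) :
    ∀ (G : Type) [Group G] [TopologicalSpace G] [IsTopologicalGroup G] [CompactSpace G],
      IsCompactSimpleLieGroup G → SimplyConnectedSpace G →
      letI : MeasurableSpace G := borel G
      haveI : BorelSpace G := ⟨rfl⟩
      ∀ (r : LatticeRep G) (a : ℝ → ℝ), (∀ β, 0 < a β) → Tendsto a atTop (𝓝 0) → LowerBounds G r a →
        ∃ T β₁ : ℝ, 0 < T ∧ ∀ β : ℝ, β₁ ≤ β → coldDefect r.ρ β ⌈T / a β⌉₊ ≤ 1 / 24 := by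
  intro G _ _ _ _ hG hsc
  letI : MeasurableSpace G := borel G
  haveI : BorelSpace G := ⟨rfl⟩
  intro r a ha ha0 hlb
  obtain ⟨T, c, β₁, hc, hrate⟩ := rateForm_of_pinnedExitAt24 hP G hG hsc r a ha ha0 hlb
  have hpos : 0 < max T (Real.log 24 / c) :=
    lt_of_lt_of_le (div_pos (Real.log_pos (by norm_num)) hc) (le_max_right _ _)
  exact ⟨max T (Real.log 24 / c), β₁, hpos, fun β hβ => designatedBox_of_rate r (ha β) hc (hrate β hβ)⟩

/-- **Designated-box form ⇒ PX(1/24) (PROVED)**: beyond `βa` with `a ≤ min 1 (T/8)` the designated box has side `≥ 8` and pin `T + 1`. -/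
theorem pinnedExitAt24_of_designated
    (hD : ∀ (G : Type) [Group G] [TopologicalSpace G] [IsTopologicalGroup G] [CompactSpace G],
      IsCompactSimpleLieGroup G → SimplyConnectedSpace G →
      letI : MeasurableSpace G := borel G
      haveI : BorelSpace G := ⟨rfl⟩
      ∀ (r : LatticeRep G) (a : ℝ → ℝ), (∀ β, 0 < a β) → Tendsto a atTop (𝓝 0) → LowerBounds G r a →
        ∃ T β₁ : ℝ, 0 < T ∧ ∀ β : ℝ, β₁ ≤ β → coldDefect r.ρ β ⌈T / a β⌉₊ ≤ 1 / 24) :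
    PinnedExitAt (1 / 24) := by
  intro G _ _ _ _ hG hsc
  letI : MeasurableSpace G := borel G
  haveI : BorelSpace G := ⟨rfl⟩
  intro r a ha ha0 hlb
  obtain ⟨T, β₁, hT, hdes⟩ := hD G hG hsc r a ha ha0 hlb
  obtain ⟨βa, hβa⟩ := eventually_le_of_tendsto_zero ha0 (lt_min one_pos (by positivity : 0 < T / 8))
  refine ⟨T + 1, max β₁ βa, fun β hβ => ?_⟩
  have hβ1 : β₁ ≤ β := le_trans (le_max_left _ _) hβ
  have hβa' : βa ≤ β := le_trans (le_max_right _ _) hβ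
  exact pinnedPureBox_of_designated r (ha β) ((hβa β hβa').trans (min_le_left _ _))
    ((hβa β hβa').trans (min_le_right _ _)) (hdes β hβ1)

/-- **PX(1/24) ↔ DESIGNATED-BOX FORM (PROVED): THE NUMBER is the purity of ONE prescribed box per coupling — the cold `4:1` torus of side
`⌈T/a(β)⌉₊`, i.e. of physical side `T` in floor units.** -/
theorem pinnedExitAt24_iff_designated :
    PinnedExitAt (1 / 24) ↔
    ∀ (G : Type) [Group G] [TopologicalSpace G] [IsTopologicalGroup G] [CompactSpace G],
      IsCompactSimpleLieGroup G → SimplyConnectedSpace G →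
      letI : MeasurableSpace G := borel G
      haveI : BorelSpace G := ⟨rfl⟩
      ∀ (r : LatticeRep G) (a : ℝ → ℝ), (∀ β, 0 < a β) → Tendsto a atTop (𝓝 0) → LowerBounds G r a →
        ∃ T β₁ : ℝ, 0 < T ∧ ∀ β : ℝ, β₁ ≤ β → coldDefect r.ρ β ⌈T / a β⌉₊ ≤ 1 / 24 :=
  ⟨designated_of_pinnedExitAt24, pinnedExitAt24_of_designated⟩

/-! ## §4 PXcof(1/24) (slot of record on 26930): the cofinal body has the same two re-typings

The body of `PinnedExitsCofinalAt θ` is spelled out verbatim (its `def` lives in the slot's `Lines/` workfile): for simply-connected compact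
simple `G`, every `r`, every floor-admissible `a`: `∃ T, ∀ β₁, ∃ β ≥ β₁, ∃ L ≥ 8, a β·L ≤ T ∧ δᶜ_β(L) ≤ θ`. -/

/-- **PXcof(1/24) ↔ COFINAL RATE FORM (PROVED)**: `∃ T, c > 0` such that for every `β₁` some `β ≥ β₁` obeys `δᶜ_β(P) ≤ exp(−c·a(β)·P)` on every box
with `a(β)·P ≥ T`. -/
theorem pinnedExitsCofinalAt24_iff_rateForm :
    (∀ (G : Type) [Group G] [TopologicalSpace G] [IsTopologicalGroup G] [CompactSpace G],
      IsCompactSimpleLieGroup G → SimplyConnectedSpace G →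
      letI : MeasurableSpace G := borel G
      haveI : BorelSpace G := ⟨rfl⟩
      ∀ (r : LatticeRep G) (a : ℝ → ℝ), (∀ β, 0 < a β) → Tendsto a atTop (𝓝 0) → LowerBounds G r a →
        ∃ T : ℝ, ∀ β₁ : ℝ, ∃ β : ℝ, β₁ ≤ β ∧ ∃ L : ℕ, 8 ≤ L ∧ a β * (L : ℝ) ≤ T ∧ coldDefect r.ρ β L ≤ 1 / 24) ↔
    ∀ (G : Type) [Group G] [TopologicalSpace G] [IsTopologicalGroup G] [CompactSpace G],
      IsCompactSimpleLieGroup G → SimplyConnectedSpace G →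
      letI : MeasurableSpace G := borel G
      haveI : BorelSpace G := ⟨rfl⟩
      ∀ (r : LatticeRep G) (a : ℝ → ℝ), (∀ β, 0 < a β) → Tendsto a atTop (𝓝 0) → LowerBounds G r a →
        ∃ T c : ℝ, 0 < c ∧ ∀ β₁ : ℝ, ∃ β : ℝ, β₁ ≤ β ∧ ∀ P : ℕ, T ≤ a β * (P : ℝ) →
          coldDefect r.ρ β P ≤ Real.exp (-(c * (a β * (P : ℝ)))) := by
  constructor
  · intro hP G _ _ _ _ hG hsc
    letI : MeasurableSpace G := borel G
    haveI : BorelSpace G := ⟨rfl⟩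
    intro r a ha ha0 hlb
    obtain ⟨T, hpx⟩ := hP G hG hsc r a ha ha0 hlb
    have hT : 0 < T := by
      obtain ⟨β, -, L, hL8, hpin, -⟩ := hpx 0
      have hLpos : (0 : ℝ) < (L : ℝ) := by exact_mod_cast (show 0 < L by omega)
      exact lt_of_lt_of_le (mul_pos (ha _) hLpos) hpin
    refine ⟨32768 * T, 1 / (16384 * T), by positivity, fun β₁ => ?_⟩
    obtain ⟨β, hβ, L, hL8, hpin, hδ⟩ := hpx (max β₁ 0)
    refine ⟨β, le_trans (le_max_left _ _) hβ, fun P hPT => ?_⟩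
    have hβ0 : (0 : ℝ) ≤ β := le_trans (le_max_right _ _) hβ
    have h := rate_of_pinnedPureBox r hβ0 (ha β) hL8 hpin hδ P hPT
    have heq : 1 / (16384 * T) * (a β * (P : ℝ)) = a β * (P : ℝ) / (16384 * T) := by ring
    rwa [heq]
  · intro hR G _ _ _ _ hG hsc
    letI : MeasurableSpace G := borel G
    haveI : BorelSpace G := ⟨rfl⟩
    intro r a ha ha0 hlb
    obtain ⟨T, c, hc, hrate⟩ := hR G hG hsc r a ha ha0 hlb
    obtain ⟨βa, hβa⟩ := eventually_le_of_tendsto_zero ha0 one_pos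
    refine ⟨max 8 (max T (Real.log 24 / c) + 1), fun β₁ => ?_⟩
    obtain ⟨β, hβ, hrb⟩ := hrate (max β₁ βa)
    exact ⟨β, le_trans (le_max_left _ _) hβ,
      pinnedPureBox_of_rate r (ha β) (hβa β (le_trans (le_max_right _ _) hβ)) hc hrb⟩

/-- **PXcof(1/24) ↔ COFINAL DESIGNATED-BOX FORM (PROVED)**: `∃ T > 0` such that for every `β₁` some `β ≥ β₁` has the ONE box `⌈T/a(β)⌉₊`
`1/24`-pure. -/
theorem pinnedExitsCofinalAt24_iff_designated :
    (∀ (G : Type) [Group G] [TopologicalSpace G] [IsTopologicalGroup G] [CompactSpace G],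
      IsCompactSimpleLieGroup G → SimplyConnectedSpace G →
      letI : MeasurableSpace G := borel G
      haveI : BorelSpace G := ⟨rfl⟩
      ∀ (r : LatticeRep G) (a : ℝ → ℝ), (∀ β, 0 < a β) → Tendsto a atTop (𝓝 0) → LowerBounds G r a →
        ∃ T : ℝ, ∀ β₁ : ℝ, ∃ β : ℝ, β₁ ≤ β ∧ ∃ L : ℕ, 8 ≤ L ∧ a β * (L : ℝ) ≤ T ∧ coldDefect r.ρ β L ≤ 1 / 24) ↔
    ∀ (G : Type) [Group G] [TopologicalSpace G] [IsTopologicalGroup G] [CompactSpace G],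
      IsCompactSimpleLieGroup G → SimplyConnectedSpace G →
      letI : MeasurableSpace G := borel G
      haveI : BorelSpace G := ⟨rfl⟩
      ∀ (r : LatticeRep G) (a : ℝ → ℝ), (∀ β, 0 < a β) → Tendsto a atTop (𝓝 0) → LowerBounds G r a →
        ∃ T : ℝ, 0 < T ∧ ∀ β₁ : ℝ, ∃ β : ℝ, β₁ ≤ β ∧ coldDefect r.ρ β ⌈T / a β⌉₊ ≤ 1 / 24 := by
  rw [pinnedExitsCofinalAt24_iff_rateForm]
  constructor
  · intro hR G _ _ _ _ hG hsc
    letI : MeasurableSpace G := borel G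
    haveI : BorelSpace G := ⟨rfl⟩
    intro r a ha ha0 hlb
    obtain ⟨T, c, hc, hrate⟩ := hR G hG hsc r a ha ha0 hlb
    have hpos : 0 < max T (Real.log 24 / c) :=
      lt_of_lt_of_le (div_pos (Real.log_pos (by norm_num)) hc) (le_max_right _ _)
    refine ⟨max T (Real.log 24 / c), hpos, fun β₁ => ?_⟩
    obtain ⟨β, hβ, hrb⟩ := hrate β₁
    exact ⟨β, hβ, designatedBox_of_rate r (ha β) hc hrb⟩
  · intro hD G _ _ _ _ hG hsc
    letI : MeasurableSpace G := borel G
    haveI : BorelSpace G := ⟨rfl⟩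
    intro r a ha ha0 hlb
    obtain ⟨T, hT, hdes⟩ := hD G hG hsc r a ha ha0 hlb
    obtain ⟨βa, hβa⟩ := eventually_le_of_tendsto_zero ha0 (lt_min one_pos (by positivity : 0 < T / 8))
    -- go through a pinned pure box at cofinally many β, then the rate at those β
    have hT1 : 0 < T + 1 := by linarith
    refine ⟨32768 * (T + 1), 1 / (16384 * (T + 1)), by positivity, fun β₁ => ?_⟩
    obtain ⟨β, hβ, hδ⟩ := hdes (max (max β₁ βa) 0)
    have hβ1 : β₁ ≤ β := le_trans ((le_max_left _ _).trans (le_max_left _ _)) hβ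
    have hβa' : βa ≤ β := le_trans ((le_max_right _ _).trans (le_max_left _ _)) hβ
    have hβ0 : (0 : ℝ) ≤ β := le_trans (le_max_right _ _) hβ
    obtain ⟨L, hL8, hpin, hδL⟩ := pinnedPureBox_of_designated r (ha β) ((hβa β hβa').trans (min_le_left _ _))
      ((hβa β hβa').trans (min_le_right _ _)) hδ
    refine ⟨β, hβ1, fun P hPT => ?_⟩
    have h := rate_of_pinnedPureBox r hβ0 (ha β) hL8 hpin hδL P hPT
    have heq : 1 / (16384 * (T + 1)) * (a β * (P : ℝ)) = a β * (P : ℝ) / (16384 * (T + 1)) := by ring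
    rwa [heq]

end Summit.QuantumFields.YangMills.Cruxes.IR.PinnedExit96.RateForm

end
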